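import Literature.AlgebraicGeometry.Motives.MixedHodgeExtensionTensorHomAdjunctionUnit
import HarnessLib

/-!
# The evaluation `Hom(C, E) ⊗ C → E` of an extension; `Hom(C, −)` and `− ⊗ C` on `Ext¹` through the adjunction

Deligne–Milne, *Tannakian categories* (LNM 900), §1 Def. 1.6: the internal Hom comes with the
evaluation `ev_{X,Y} : Hom(X, Y) ⊗ X → Y`, natural in `Y` (and dinatural in `X`), the counit of
`− ⊗ X ⊣ Hom(X, −)` ((1.6.1)); Jannsen, *Mixed Motives* (LNM 1400), §9 Remark 9.3 a): push-out "via the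
evaluation map `Hom(A,B) ⊗ A → B`" on extensions of mixed Hodge structures. Mac Lane, *Homology* III
Prop. 1.8: `β_* E ≡ α^* E'` along a morphism of extensions `(β, φ, α) : E → E'`.

For an extension `E : 0 → B → E → A → 0` of mixed Hodge structures and a mixed Hodge structure `C`
(finite-dimensional carriers), with `Hom(C, E)` (`MixedHodgeExtensionHomFunctor`), the unit/counit form of
the adjunction `adj : Ext(A ⊗ C, B) ≅ Ext(A, Hom(C, B))` (`MixedHodgeExtensionTensorHomAdjunctionUnit`):

* §1 **naturality of the evaluation**: `ev_{C,Y} ∘ (Hom(C, g) ⊗ 1_C) = g ∘ ev_{C,X}` for `g : X → Y`, and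
  dinaturality `ev_{C',X} ∘ (Hom(h, X) ⊗ 1_{C'}) = ev_{C,X} ∘ (1 ⊗ h)` for `h : C' → C`;
* §2 **the morphism of extensions `ev : Hom(C, E) ⊗ C → E`** over `ev_{C,B}`, `ev_{C,A}`
  (`Extension.homLeftRTensorToSelf`), hence `ev_* (Hom(C, E) ⊗ C) ≡ ev^* E`;
* §3 on `Ext`: **`(ev_{C,B})_* (Hom(C, x) ⊗ C) = (ev_{C,A})^* x`**, so
  **`Hom(C, x) = adj((ev_{C,A})^* x)`** and `adj⁻¹(Hom(C, x)) = (ev_{C,A})^* x`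
  (`Ext.homLeftMap_eq_tensorHomAdj_pullbackMapW_homEval`), and dually
  **`x ⊗ C = adj⁻¹((coev_{B,C})_* x)`**, `adj(x ⊗ C) = (coev_{B,C})_* x`
  (`Ext.rTensorMap_eq_tensorHomAdj_symm_pushoutMapW_tensorCoev`); the vanishing criteria
  `Hom(C, x) = 0 ↔ (ev_{C,A})^* x = 0`, `x ⊗ C = 0 ↔ (coev_{B,C})_* x = 0`; the round trip
  `(coev)^* Hom(C, (ev)^* x) = Hom(C, x)`.

All statements proved; no named facts.

## References

* [DeligneMilne1982Tannakian] P. Deligne, J. S. Milne, Tannakian categories, LNM 900 (1982), §1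
  Def. 1.6, (1.6.1).
* [Jannsen1990MixedMotives] U. Jannsen, Mixed Motives and Algebraic K-Theory, LNM 1400 (1990), §9
  Remark 9.3 a).
* [MacLane1963Homology] S. Mac Lane, Homology (1963), Ch. III §1 Prop. 1.8.
* [DeligneHodgeII1971] P. Deligne, Théorie de Hodge II, 1.1.12.
-/

noncomputable section

open scoped TensorProduct

namespace Literature.AlgebraicGeometry.Motives

namespace MixedHodgeStructure

/-! ### §1 Naturality of the evaluation -/

section Naturality

variable {VC : Type*} [AddCommGroup VC] [Module ℚ VC] [FiniteDimensional ℚ VC]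
variable {VC' : Type*} [AddCommGroup VC'] [Module ℚ VC'] [FiniteDimensional ℚ VC']
variable {VX : Type*} [AddCommGroup VX] [Module ℚ VX] [FiniteDimensional ℚ VX]
variable {VY : Type*} [AddCommGroup VY] [Module ℚ VY] [FiniteDimensional ℚ VY]
variable {C : MixedHodgeStructure VC} {C' : MixedHodgeStructure VC'}
variable {X : MixedHodgeStructure VX} {Y : MixedHodgeStructure VY}

/-- **`ev_{C,Y} ∘ (Hom(C, g) ⊗ 1_C) = g ∘ ev_{C,X}`**: the evaluation is natural in the covariant variable
(`(g ∘ f)(c) = g(f(c))`). [cite: DeligneMilne1982Tannakian, §1 Def. 1.6] -/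
theorem homEval_comp_homMap_id_tensorMap_id (C : MixedHodgeStructure VC) (g : Hom X Y) :
    (homEval C Y).comp ((Hom.homMap (Hom.id C) g).tensorMap (Hom.id C)) = g.comp (homEval C X) :=
  Hom.ext (TensorProduct.ext' fun f c => by
    simp only [Hom.comp_toLinearMap, LinearMap.comp_apply, Hom.tensorMap_apply_tmul, Hom.id_toLinearMap,
      LinearMap.id_apply, homEval_apply_tmul, Hom.homMap_toLinearMap_apply, LinearMap.comp_id])

/-- **`ev_{C',X} ∘ (Hom(h, X) ⊗ 1_{C'}) = ev_{C,X} ∘ (1 ⊗ h)`** for `h : C' → C`: dinaturality of the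
evaluation (`(f ∘ h)(c') = f(h(c'))`). [cite: DeligneMilne1982Tannakian, §1 Def. 1.6] -/
theorem homEval_comp_homMap_tensorMap_id (X : MixedHodgeStructure VX) (h : Hom C' C) :
    (homEval C' X).comp ((Hom.homMap h (Hom.id X)).tensorMap (Hom.id C')) =
      (homEval C X).comp ((Hom.id (hom C X)).tensorMap h) :=
  Hom.ext (TensorProduct.ext' fun f c' => by
    simp only [Hom.comp_toLinearMap, LinearMap.comp_apply, Hom.tensorMap_apply_tmul, Hom.id_toLinearMap,
      LinearMap.id_apply, homEval_apply_tmul, Hom.homMap_toLinearMap_apply, LinearMap.id_comp])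

end Naturality

/-! ### §2 The morphism of extensions `Hom(C, E) ⊗ C → E` -/

section Extensions

variable {VA : Type*} [AddCommGroup VA] [Module ℚ VA] [FiniteDimensional ℚ VA]
variable {VB : Type*} [AddCommGroup VB] [Module ℚ VB] [FiniteDimensional ℚ VB]
variable {VC : Type*} [AddCommGroup VC] [Module ℚ VC] [FiniteDimensional ℚ VC]
variable {VE : Type*} [AddCommGroup VE] [Module ℚ VE] [FiniteDimensional ℚ VE]
variable {A : MixedHodgeStructure VA} {B : MixedHodgeStructure VB}

namespace Extension

variable (E : Extension A B VE) (C : MixedHodgeStructure VC)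

/-- **The evaluation morphism of extensions `ev : Hom(C, E) ⊗ C → E`** over `ev_{C,B} : Hom(C, B) ⊗ C → B`
and `ev_{C,A}` (squares by naturality of `ev`: `ev ∘ (Hom(C, i) ⊗ 1) = i ∘ ev`, `ev ∘ (Hom(C, π) ⊗ 1) = π ∘ ev`).
[cite: DeligneMilne1982Tannakian, §1 Def. 1.6] [cite: Jannsen1990MixedMotives, §9 Remark 9.3 a)] -/
def homLeftRTensorToSelf : Morphism ((E.homLeft C).rTensor C) E where
  left := homEval C B
  mid := homEval C E.mhs
  right := homEval C A
  mid_inc := by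
    change (homEval C E.mhs).toLinearMap ∘ₗ ((Hom.homMap (Hom.id C) E.inc).tensorMap (Hom.id C)).toLinearMap =
      E.inc.toLinearMap ∘ₗ (homEval C B).toLinearMap
    rw [← Hom.comp_toLinearMap, ← Hom.comp_toLinearMap, homEval_comp_homMap_id_tensorMap_id]
  proj_mid := by
    change E.proj.toLinearMap ∘ₗ (homEval C E.mhs).toLinearMap =
      (homEval C A).toLinearMap ∘ₗ ((Hom.homMap (Hom.id C) E.proj).tensorMap (Hom.id C)).toLinearMap
    rw [← Hom.comp_toLinearMap, ← Hom.comp_toLinearMap, homEval_comp_homMap_id_tensorMap_id]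

/-- Components of `Hom(C, E) ⊗ C → E` (by `rfl`). [cite: DeligneMilne1982Tannakian, §1 Def. 1.6] -/
@[simp]
theorem homLeftRTensorToSelf_left : (E.homLeftRTensorToSelf C).left = homEval C B := rfl

/-- Components of `Hom(C, E) ⊗ C → E` (by `rfl`). [cite: DeligneMilne1982Tannakian, §1 Def. 1.6] -/
@[simp]
theorem homLeftRTensorToSelf_mid : (E.homLeftRTensorToSelf C).mid = homEval C E.mhs := rfl

/-- Components of `Hom(C, E) ⊗ C → E` (by `rfl`). [cite: DeligneMilne1982Tannakian, §1 Def. 1.6] -/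
@[simp]
theorem homLeftRTensorToSelf_right : (E.homLeftRTensorToSelf C).right = homEval C A := rfl

/-- **`(ev_{C,B})_* (Hom(C, E) ⊗ C) ≡ (ev_{C,A})^* E`** (Mac Lane III Prop. 1.8 along the evaluation).
[cite: MacLane1963Homology, Ch. III Prop. 1.8] [cite: Jannsen1990MixedMotives, §9 Remark 9.3 a)] -/
theorem nonempty_congruence_homLeft_rTensor_pushout_homEval_pullback :
    Nonempty (Congruence (((E.homLeft C).rTensor C).pushout (homEval C B)) (E.pullback (homEval C A))) :=
  nonempty_congruence_pushout_pullback_of_morphism (E.homLeftRTensorToSelf C)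

/-- In the complete invariant: `(ev_{C,B})_* [Hom(C, E) ⊗ C]_W = (ev_{C,A})^* [E]_W`.
[cite: MacLane1963Homology, Ch. III Prop. 1.8] -/
theorem postcomp_homEval_clsW_homLeft_rTensor :
    JHomW.postcomp (tensor (hom C A) C) (homEval C B) ((E.homLeft C).rTensor C).clsW =
      JHomW.precomp B (homEval C A) E.clsW :=
  (E.homLeftRTensorToSelf C).postcomp_clsW_eq_precomp_clsW

end Extension

/-! ### §3 `Hom(C, −)` and `− ⊗ C` on `Ext¹` through the adjunction -/

namespace Ext

variable (C : MixedHodgeStructure VC)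

/-- **`(ev_{C,B})_* (Hom(C, x) ⊗ C) = (ev_{C,A})^* x`** on `Ext(A, B)`. [cite: MacLane1963Homology, Ch. III Prop. 1.8]
[cite: DeligneMilne1982Tannakian, §1 Def. 1.6] -/
theorem pushoutMapW_homEval_rTensorMap_homLeftMap (x : Ext A B) :
    pushoutMapW (homEval C B) (rTensorMap C (homLeftMap C x)) = pullbackMapW (homEval C A) x := by
  obtain ⟨E, rfl⟩ := exists_mkOfW_eq x
  rw [homLeftMap_mkOfW, rTensorMap_mkOfW]
  exact pushoutMapW_mkOfW_eq_pullbackMapW_mkOfW (E.homLeftRTensorToSelf C)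

/-- **`adj⁻¹(Hom(C, x)) = (ev_{C,A})^* x`**: under `Ext(Hom(C, A) ⊗ C, B) ≅ Ext(Hom(C, A), Hom(C, B))` the
class `Hom(C, x)` corresponds to the pull-back of `x` along the evaluation. [cite: DeligneMilne1982Tannakian, §1 (1.6.1)] -/
theorem tensorHomAdj_symm_homLeftMap (x : Ext A B) :
    (tensorHomAdj (hom C A) C B).symm (homLeftMap C x) = pullbackMapW (homEval C A) x := by
  rw [tensorHomAdj_symm_eq_pushoutMapW_homEval, pushoutMapW_homEval_rTensorMap_homLeftMap]

/-- **`Hom(C, x) = adj((ev_{C,A})^* x)`**: the internal Hom on `Ext¹` is the adjoint of pulling back along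
the evaluation. [cite: DeligneMilne1982Tannakian, §1 (1.6.1)] [cite: Jannsen1990MixedMotives, §9 Remark 9.3 a)] -/
theorem homLeftMap_eq_tensorHomAdj_pullbackMapW_homEval (x : Ext A B) :
    homLeftMap C x = tensorHomAdj (hom C A) C B (pullbackMapW (homEval C A) x) := by
  rw [← tensorHomAdj_symm_homLeftMap, Equiv.apply_symm_apply]

/-- `Hom(C, x)` splits iff `(ev_{C,A})^* x` splits. [cite: DeligneMilne1982Tannakian, §1 (1.6.1)] -/
theorem homLeftMap_eq_zeroW_iff_pullbackMapW_homEval (x : Ext A B) :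
    homLeftMap C x = zeroW ↔ pullbackMapW (homEval C A) x = zeroW := by
  rw [homLeftMap_eq_tensorHomAdj_pullbackMapW_homEval, tensorHomAdj_eq_zeroW_iff]

/-- **`adj(x ⊗ C) = (coev_{B,C})_* x`**: under `Ext(A ⊗ C, B ⊗ C) ≅ Ext(A, Hom(C, B ⊗ C))` the class
`x ⊗ C` corresponds to the push-out of `x` along the coevaluation `B → Hom(C, B ⊗ C)`.
[cite: DeligneMilne1982Tannakian, §1 (1.6.1)] -/
theorem tensorHomAdj_rTensorMap (x : Ext A B) :
    tensorHomAdj A C (tensor B C) (rTensorMap C x) = pushoutMapW (tensorCoev B C) x := by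
  rw [tensorHomAdj_eq_pullbackMapW_tensorCoev, pushoutMapW_tensorCoev]

/-- **`x ⊗ C = adj⁻¹((coev_{B,C})_* x)`**: tensoring on `Ext¹` is the inverse adjoint of pushing out along
the coevaluation. [cite: DeligneMilne1982Tannakian, §1 (1.6.1)] [cite: Jannsen1990MixedMotives, §9 Remark 9.3 a)] -/
theorem rTensorMap_eq_tensorHomAdj_symm_pushoutMapW_tensorCoev (x : Ext A B) :
    rTensorMap C x = (tensorHomAdj A C (tensor B C)).symm (pushoutMapW (tensorCoev B C) x) := by
  rw [← tensorHomAdj_rTensorMap, Equiv.symm_apply_apply]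

/-- `x ⊗ C` splits iff `(coev_{B,C})_* x` splits. [cite: DeligneMilne1982Tannakian, §1 (1.6.1)] -/
theorem rTensorMap_eq_zeroW_iff_pushoutMapW_tensorCoev (x : Ext A B) :
    rTensorMap C x = zeroW ↔ pushoutMapW (tensorCoev B C) x = zeroW := by
  rw [← tensorHomAdj_eq_zeroW_iff A C (tensor B C), tensorHomAdj_rTensorMap]

/-- **Round trip**: `(coev_{Hom(C,A),C})^* Hom(C, (ev_{C,A})^* x) = Hom(C, x)` — `adj((ev)^* x)` computed by
the unit form of the adjunction. [cite: DeligneMilne1982Tannakian, §1 Def. 1.6] -/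
theorem pullbackMapW_tensorCoev_homLeftMap_pullbackMapW_homEval (x : Ext A B) :
    pullbackMapW (tensorCoev (hom C A) C) (homLeftMap C (pullbackMapW (homEval C A) x)) = homLeftMap C x := by
  rw [← tensorHomAdj_eq_pullbackMapW_tensorCoev, ← homLeftMap_eq_tensorHomAdj_pullbackMapW_homEval]

end Ext

end Extensions

end MixedHodgeStructure

end Literature.AlgebraicGeometry.Motives

end
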